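import Summits.QuantumFields.YangMills.Theorems.BalabanUVNodesN21SelectedTopCut13CoPH

/-!
# N21 (NE7c) · THE GAPPED TOP CUT — definition lane: the (3.2) label weight of the last 𝐓-step with TWO letters (small-field factors at `θlo`, NEW large-field
# factors at `θhi`, the gap `(θlo, θhi)` OPEN), its resummed step weights, the gapped top slot ∕ core, the TWO-SIDED COLLAR SHELL of a top-lettered term, and the
# collar count functional

R134 seat `pub-ymgap-dag-n21-d` (g11), node N21 = NE7c (NOT PRINTED; NOT proved at print's fixed thresholds), strategy s2; lane K3⁷ `SpineGivenEndpointR13SepCoPH`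
(stmt-QuantumFields-20544, `--supports … --as helper`; COUNT-NEUTRAL).  DEFINITION LANE: seven `def`s + faces; NO estimate.  Imports this seat's T2
`…N21SelectedTopCut13CoPH` (p607365; through it T1 `…SelectedTopCut13CoPHDefs`: `topLetter`, `wTopAt`, `topSlotAt`, `topClassWeightAt`; def-T FILE 19
`Node00/StepWeightsAtThresholds`: `aWeightAt`, `bWeightAt`, `chiFactorAt`, `chiSeqOfRecordAt`, `tstepOfRecordAt`, `twoDeltaLetterOfRecord`; def-T FILE 2 `stepWeightsOfResum`).
[III] = [Balaban1988Convergent], [LF-I] = [Balaban1989LargeFieldI].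

WHY (LOCATED against this seat's own ROAD-S, g10 R1–R4).  `T4IndicatorShell`'s design (i) (the cell's decision of record) compares the two runs' terms FACTOR BY FACTOR at the
common driving field with IDENTICAL core indicators `χ^Aχ^B` and sends BOTH mixed pieces `χ^A(1 − χ^B)`, `(1 − χ^A)χ^B` to the bad class; under sup-closeness of the tested
backgrounds they are dominated by single-run shells on BOTH sides of the cut (`T4IndicatorShell` §3 `smallInd_mul_one_sub_le` AND `largeInd_mul_one_sub_le`).  The top-lettered
term of T1 at letter `θ` carries, at the top level, the small-field factors `χf^{θ}_c` of the χ_{k+1}-cubes `c ∈ cubes32(s) ∖ P` AND the new large-field factors `1 − χf^{θ}_c`,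
`c ∈ P = P_{k+1}`, INSIDE def-T's resummed (3.2) weight `a|_θ(P)` ([III] (3.2) p.265).  ROAD-S banded only the front factor (inside, below the cut).  THIS FILE types the
GAPPED (3.2) weight — small-field factors at the LOWER letter `θlo`, large-field factors at the UPPER letter `θhi` — so that the gapped core of the term at `θ ∈ [θlo, θhi]` has NO
top cube statistic in the open collar `(θlo, θhi)`, and the shell `term − gapped core` is the TWO-SIDED collar.  [LF-I] p. 181: «for these we change the regularity conditions
by a factor» — print's threshold ladders are letters, not sharp numbers.  Companion (theorems: cover, graph identities, the two-sided pigeonhole, the common depth):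
`…N21GappedTopCut13CoPH`.

WHAT IS DEFINED (NODE 00's generality `ν M p g k` ∕ `ϑ D g₀ os p g k`; the top is level `k + 1`, meant at `k + 1 = p.K`).
* `aGapAt … θlo θhi s P V′ := [P ⊆ cubes32 s] · χ_{k+1}(cubes32 s ∖ P)|_{θlo}(V′) · χᶜ_{k+1}(P)|_{θhi}(V′)` — def-T's `aWeightAt` with the two product halves read at two letters.
* `ωGapAt … θlo θhi δ′ ζ s t := aGapAt(t.1) · b|_{δ′}(t.1, t.2.1) · ζ(t)` and ★ `wGapAt ϑ θlo θhi : StepWeightsOfRecord` (resummed along `σOfRecord`, (3.3) letter `2δ_k` and `ζ`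
  of record — exactly `wTopAt`'s companions).
* ★ `topGapSlotAt … θlo θhi t s′ := tstepOfRecordAt (topLetter ν θlo) (wGapAt ϑ θlo θhi) … (dressedSlotsOfDatum₉ … t p g k) s′`, `topGapCoreAt … := ∫ χ_{k+1}^{θlo}(s′)·topGapSlot`,
  ★ `topGapShellAt … θlo θ θhi t s′ := topClassWeightAt … θ t s′ − topGapCoreAt … θlo θhi t s′`.
* `collarAt ν p g k θlo θhi V′ := Σ_{c : Iχ} (χf^{θhi}_c(V′) − χf^{θlo}_c(V′))` — the number of χ_{k+1}-cubes whose (2.17) statistic lies in the collar `[θlo, θhi)`.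
* Faces: unfoldings; `aGapAt_nonneg`, `aGapAt_le_aWeightAt` (`θlo ≤ θ ≤ θhi`), `front_absorb_gap`; `wGapAt_nonneg` (`0 ≤ ζ`), `abs_wGapAt_le_one` (`Σ|ζ| ≤ 1`),
  `measurable_wGapAt` ((H-ζ)); `topGapSlotAt_nonneg`, `topGapCoreAt_nonneg`; `collarAt_nonneg ∕ _le_card`, `measurable_collarAt`.

HONEST FRAMING (binding).  Definitions + [folklore] bookkeeping; NO estimate of Bałaban's asserted or used; ONLY the (2.17)∕(3.2) factor family of the TOP step is
re-lettered (the (3.3) `b|_{2δ_k}` family, the ℝ-side, the selector and everything below the top are print's ∕ the record's — their two-run shells are LOCATED, not typed);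
the top 𝐑-step is omitted as in T1 (integral-preserving); the common-refinement inequality «design (i) shell ≤ gapped shell» needs the two-run site identification and N16's
sup-closeness and is the CONSUMER's (N19′ ∕ U5), NOT typed here; no lettered spine READING is typed here; no `Provisos₁₃CoPH` inhabitant claimed (K0⁷ open); NE7c NOT
PRINTED ∕ NOT proved at print's thresholds; N21 NOT discharged; K3⁷ NOT claimed; counts UNMOVED (typed 28∕28 · discharged 5∕27); never a count claim.  No `sorry`, no
`axiom`, no `instance`, no `notation`.  One finite four-torus programme at fixed `ε` — NOT ℝ⁴, NOT OS, NOT a mass gap, NOT the Clay problem.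
-/

noncomputable section

open scoped BigOperators
open Finset MeasureTheory

namespace Summit.QuantumFields.YangMills.Theorems.N21ShellSplitOfRecord13CoPH

open Literature.MathematicalPhysics.QuantumFieldTheory.Balaban1983to89
open Literature.MathematicalPhysics.QuantumFieldTheory.Balaban1983to89.T4Continuum
open Literature.MathematicalPhysics.QuantumFieldTheory.Balaban1983to89.Node00
open Summit.QuantumFields.YangMills.BalabanUVNodes.N19MGFRoadLiveSelectorTower (dressedSlotsOfDatum₉_nonneg)
open Summit.QuantumFields.YangMills.BalabanUVNodes.N19MGFFormAtRecord (wOfRecord₉_nonneg)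
open B14.Sect3Decomp (chiNext chiNextc)

/-! ## §27 The gapped (3.2) label weight, its label ∕ step weights -/

section GapWeight

variable (F : T4Family) (N : ℕ) [NeZero N] (ν : Stage7Numerics) (M : ℕ) (p : B12.RunParams) (g : ℕ → ℝ) (k : ℕ)

/-- **THE GAPPED (3.2) LABEL WEIGHT** of `P_{k+1}` with small-field letter `θlo` and large-field letter `θhi`:
`[P ⊆ cubes32 s] · χ_{k+1}(cubes32 s ∖ P)|_{θlo} · χᶜ_{k+1}(P)|_{θhi}` — def-T's `aWeightAt … ε` is the instance `θlo = θhi = ε`. [bookkeeping] -/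
def aGapAt (θlo θhi : ℝ) (s : SeqOfRecord F ν M g p.K k) (Pl : Finset (Iχ F ν p g k)) (V' : GaugeField (F.P p.K) (k + 1) (SU N)) : ℝ :=
  if Pl ⊆ cubes32 F ν M p g k s then
    chiNext (sect3DataOfRecord F N ν M p g k s) θlo (cubes32 F ν M p g k s \ Pl : Finset (Iχ F ν p g k)) V' *
      chiNextc (sect3DataOfRecord F N ν M p g k s) θhi Pl V'
  else 0

/-- Face: at equal letters the gapped weight IS def-T's `aWeightAt` (definitional). [bookkeeping] -/
theorem aGapAt_self (ε : ℝ) : aGapAt F N ν M p g k ε ε = aWeightAt F N ν M p g k ε := rfl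

/-- Unfolding on the (3.2) range: the two product halves over the χ_{k+1}-cube factors of record. [bookkeeping] -/
theorem aGapAt_of_subset (θlo θhi : ℝ) (s : SeqOfRecord F ν M g p.K k) {Pl : Finset (Iχ F ν p g k)} (hP : Pl ⊆ cubes32 F ν M p g k s)
    (V' : GaugeField (F.P p.K) (k + 1) (SU N)) :
    aGapAt F N ν M p g k θlo θhi s Pl V' =
      (∏ c ∈ cubes32 F ν M p g k s \ Pl, chiFactorAt F N ν p g k θlo c V') * ∏ c ∈ Pl, (1 - chiFactorAt F N ν p g k θhi c V') := by
  rw [aGapAt, if_pos hP]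
  rfl

/-- Unfolding off the (3.2) range: `0`. [bookkeeping] -/
theorem aGapAt_of_not_subset (θlo θhi : ℝ) (s : SeqOfRecord F ν M g p.K k) {Pl : Finset (Iχ F ν p g k)} (hP : ¬ Pl ⊆ cubes32 F ν M p g k s)
    (V' : GaugeField (F.P p.K) (k + 1) (SU N)) : aGapAt F N ν M p g k θlo θhi s Pl V' = 0 := by
  rw [aGapAt, if_neg hP]

/-- def-T's `aWeightAt` unfolded the same way (for side-by-side comparison). [bookkeeping] -/
theorem aWeightAt_of_subset (ε : ℝ) (s : SeqOfRecord F ν M g p.K k) {Pl : Finset (Iχ F ν p g k)} (hP : Pl ⊆ cubes32 F ν M p g k s)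
    (V' : GaugeField (F.P p.K) (k + 1) (SU N)) :
    aWeightAt F N ν M p g k ε s Pl V' =
      (∏ c ∈ cubes32 F ν M p g k s \ Pl, chiFactorAt F N ν p g k ε c V') * ∏ c ∈ Pl, (1 - chiFactorAt F N ν p g k ε c V') := by
  rw [aWeightAt, if_pos hP]
  rfl

/-- `0 ≤` the gapped weight. [bookkeeping] -/
theorem aGapAt_nonneg (θlo θhi : ℝ) (s : SeqOfRecord F ν M g p.K k) (Pl : Finset (Iχ F ν p g k)) (V' : GaugeField (F.P p.K) (k + 1) (SU N)) :
    0 ≤ aGapAt F N ν M p g k θlo θhi s Pl V' := by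
  by_cases hP : Pl ⊆ cubes32 F ν M p g k s
  · rw [aGapAt_of_subset F N ν M p g k θlo θhi s hP]
    exact mul_nonneg (Finset.prod_nonneg fun c _ => chiFactorAt_nonneg F N ν p g k θlo c V')
      (Finset.prod_nonneg fun c _ => sub_nonneg.2 (chiFactorAt_le_one F N ν p g k θhi c V'))
  · rw [aGapAt_of_not_subset F N ν M p g k θlo θhi s hP]

/-- **THE GAPPED WEIGHT IS BELOW THE ONE-LETTER WEIGHT AT EVERY LETTER IN THE GAP**: `θlo ≤ θ ≤ θhi ⇒ aGap(θlo, θhi) ≤ a|_θ` (the (2.17) factor is monotone in its letter,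
def-T `chiFactorAt_mono`; all factors in `[0,1]`). [bookkeeping] -/
theorem aGapAt_le_aWeightAt {θlo θ θhi : ℝ} (hlo : θlo ≤ θ) (hhi : θ ≤ θhi) (s : SeqOfRecord F ν M g p.K k) (Pl : Finset (Iχ F ν p g k))
    (V' : GaugeField (F.P p.K) (k + 1) (SU N)) : aGapAt F N ν M p g k θlo θhi s Pl V' ≤ aWeightAt F N ν M p g k θ s Pl V' := by
  by_cases hP : Pl ⊆ cubes32 F ν M p g k s
  · rw [aGapAt_of_subset F N ν M p g k θlo θhi s hP, aWeightAt_of_subset F N ν M p g k θ s hP]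
    refine mul_le_mul ?_ ?_ (Finset.prod_nonneg fun c _ => sub_nonneg.2 (chiFactorAt_le_one F N ν p g k θhi c V'))
      (Finset.prod_nonneg fun c _ => chiFactorAt_nonneg F N ν p g k θ c V')
    · exact Finset.prod_le_prod (fun c _ => chiFactorAt_nonneg F N ν p g k θlo c V') fun c _ => chiFactorAt_mono F N ν p g k hlo c V'
    · exact Finset.prod_le_prod (fun c _ => sub_nonneg.2 (chiFactorAt_le_one F N ν p g k θhi c V'))
        fun c _ => sub_le_sub_left (chiFactorAt_mono F N ν p g k hhi c V') 1
  · rw [aGapAt_of_not_subset F N ν M p g k θlo θhi s hP, aWeightAt, if_neg hP]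

/-- Absorbing a sub-product of idempotent factors: `(Π_X f)(Π_Y f) = Π_Y f` for `X ⊆ Y`, `f·f = f` (def-T's private device, restated). [folklore] -/
theorem prod_mul_prod_of_subset_of_mul_self {ι : Type*} {X Y : Finset ι} (h : X ⊆ Y) (f : ι → ℝ)
    (hf : ∀ c, f c * f c = f c) : (∏ c ∈ X, f c) * ∏ c ∈ Y, f c = ∏ c ∈ Y, f c := by
  classical
  rw [← Finset.prod_sdiff h, mul_comm (∏ c ∈ Y \ X, f c), ← mul_assoc, ← Finset.prod_mul_distrib,
    Finset.prod_congr rfl fun c _ => hf c]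

/-- **FRONT-FACTOR ABSORPTION FOR THE GAPPED WEIGHT**: `χ_{k+1}(Ω_{k+1}(t))|_{θlo} · aGap(θlo, θhi)(P) = aGap(θlo, θhi)(P)` — the χ_{k+1}-cubes inside `Ω_{k+1}(t)` are
(3.2)-cubes outside `P` (def-T `cubesIn_OmegaOfLabel_subset`) and the small-field half of the gapped weight reads the SAME letter `θlo`. [bookkeeping] -/
theorem front_absorb_gap (θlo θhi : ℝ) (s : SeqOfRecord F ν M g p.K k) (t : LbOfRecord F ν p g k) (V' : GaugeField (F.P p.K) (k + 1) (SU N)) :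
    chiSeqOfRecordAt F N ν M g p.K (k + 1) θlo (σOfRecord F ν M p g k s t) V' * aGapAt F N ν M p g k θlo θhi s t.1 V' =
      aGapAt F N ν M p g k θlo θhi s t.1 V' := by
  by_cases hP : t.1 ⊆ cubes32 F ν M p g k s
  · rw [aGapAt_of_subset F N ν M p g k θlo θhi s hP, chiSeqOfRecordAt_succ_σOfRecord, ← mul_assoc]
    congr 1
    exact prod_mul_prod_of_subset_of_mul_self (cubesIn_OmegaOfLabel_subset F ν M p g k s t)
      (fun c => chiFactorAt F N ν p g k θlo c V') (fun c => chiFactorAt_mul_self F N ν p g k θlo c V')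
  · rw [aGapAt_of_not_subset F N ν M p g k θlo θhi s hP, mul_zero]

/-- **THE GAPPED LABEL WEIGHT** `ωGap s t (U, V′) := aGap(t.1)(V′) · b|_{δ′}(t.1, t.2.1)(U, V′) · ζ(t)(U, V′)` — def-T's `ωOfRecordAt ε δ′ ζ` with `a|_ε` replaced by the
gapped (3.2) weight; the (3.3) letter `δ′` and the residual `ζ` untouched. [bookkeeping] -/
def ωGapAt (θlo θhi δ' : ℝ) (ζ : ZetaOfRecord F N ν M) (s : SeqOfRecord F ν M g p.K k) (t : LbOfRecord F ν p g k)
    (U : GaugeField (F.P p.K) k (SU N)) (V' : GaugeField (F.P p.K) (k + 1) (SU N)) : ℝ :=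
  aGapAt F N ν M p g k θlo θhi s t.1 V' * bWeightAt F N ν M p g k δ' s t.1 t.2.1 U V' * ζ p g k s t.1 t.2.1 t.2.2 U V'

end GapWeight

section StepWeights

variable (F : T4Family) (N : ℕ) [NeZero N] (ϑ : Stage9Params F N)

/-- ★ **THE GAPPED STEP WEIGHTS** `wGapAt ϑ θlo θhi : StepWeightsOfRecord`: def-T FILE 2's resummation along `σOfRecord` of the gapped label weights, with the (3.3)
letter `2δ_k` and the residual `ζ` OF RECORD (the companions of T1's `wTopAt ϑ θ`, which is the instance `θlo = θhi = θ` at the top step). The same gap letters are used at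
every step; only the top step is ever read. [bookkeeping] -/
def wGapAt (θlo θhi : ℝ) : StepWeightsOfRecord F N ϑ.ν ϑ.τ9.M :=
  stepWeightsOfResum F N ϑ.ν ϑ.τ9.M (LbOfRecord F ϑ.ν) (σOfRecord F ϑ.ν ϑ.τ9.M)
    (fun p g k => ωGapAt F N ϑ.ν ϑ.τ9.M p g k θlo θhi (twoDeltaLetterOfRecord ϑ.ν ϑ.A₁ p g k) ϑ.ζ)

variable (p : B12.RunParams) (g : ℕ → ℝ) (k : ℕ)

/-- Unfolding of `wGapAt` at `(p, g, k)`. [bookkeeping] -/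
theorem wGapAt_apply (θlo θhi : ℝ) :
    wGapAt F N ϑ θlo θhi p g k =
      resumWeights (σOfRecord F ϑ.ν ϑ.τ9.M p g k) (ωGapAt F N ϑ.ν ϑ.τ9.M p g k θlo θhi (twoDeltaLetterOfRecord ϑ.ν ϑ.A₁ p g k) ϑ.ζ) := rfl

/-- Unfolding of T1's `wTopAt` at `(p, g, k)` (def-T `wOfRecordAt_apply`), for side-by-side use. [bookkeeping] -/
theorem wTopAt_apply (θ : ℝ) :
    wTopAt F N ϑ θ p g k =
      resumWeights (σOfRecord F ϑ.ν ϑ.τ9.M p g k)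
        (ωOfRecordAt F N ϑ.ν ϑ.τ9.M p g k (topLetter ϑ.ν θ p g (k + 1)) (twoDeltaLetterOfRecord ϑ.ν ϑ.A₁ p g k) ϑ.ζ) := rfl

/-- `0 ≤` the gapped step weights at `0 ≤ ζ`. [bookkeeping] -/
theorem wGapAt_nonneg (hζ0 : ∀ p g k s Pl Ql RS U V', 0 ≤ ϑ.ζ p g k s Pl Ql RS U V') (θlo θhi : ℝ) (s' : SeqOfRecord F ϑ.ν ϑ.τ9.M g p.K (k + 1))
    (U : GaugeField (F.P p.K) k (SU N)) (V' : GaugeField (F.P p.K) (k + 1) (SU N)) : 0 ≤ wGapAt F N ϑ θlo θhi p g k s' U V' := by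
  classical
  rw [wGapAt_apply]
  unfold resumWeights
  refine Finset.sum_nonneg fun t _ => ?_
  unfold ωGapAt
  exact mul_nonneg (mul_nonneg (aGapAt_nonneg F N ϑ.ν ϑ.τ9.M p g k _ _ _ _ _) (bWeightAt_nonneg F N ϑ.ν ϑ.τ9.M p g k _ _ _ _ _ _))
    (hζ0 _ _ _ _ _ _ _ _ _)

/-- `Σ_t |ωGap s t| ≤ 1` at `Σ|ζ| ≤ 1`, for `θlo ≤ θhi`: the gapped weight is below `a|_{θlo}`, and def-T's (O3) at the letter `θlo`. [bookkeeping] -/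
theorem sum_abs_ωGapAt_le_one (hζ1 : IsZetaAbsLeOne F N ϑ.ν ϑ.τ9.M ϑ.ζ) {θlo θhi : ℝ} (hgap : θlo ≤ θhi) (δ' : ℝ)
    (s : SeqOfRecord F ϑ.ν ϑ.τ9.M g p.K k) (U : GaugeField (F.P p.K) k (SU N)) (V' : GaugeField (F.P p.K) (k + 1) (SU N)) :
    ∑ t : LbOfRecord F ϑ.ν p g k, |ωGapAt F N ϑ.ν ϑ.τ9.M p g k θlo θhi δ' ϑ.ζ s t U V'| ≤ 1 := by
  refine le_trans (Finset.sum_le_sum fun t _ => ?_) (sum_abs_ωOfRecordAt_le_one F N ϑ.ν ϑ.τ9.M p g k θlo δ' hζ1 s U V')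
  unfold ωGapAt ωOfRecordAt
  rw [abs_mul, abs_mul, abs_mul, abs_mul, abs_of_nonneg (aGapAt_nonneg F N ϑ.ν ϑ.τ9.M p g k _ _ _ _ _),
    abs_of_nonneg (aWeightAt_nonneg F N ϑ.ν ϑ.τ9.M p g k _ _ _ _)]
  exact mul_le_mul_of_nonneg_right (mul_le_mul_of_nonneg_right (aGapAt_le_aWeightAt F N ϑ.ν ϑ.τ9.M p g k le_rfl hgap _ _ _) (abs_nonneg _))
    (abs_nonneg _)

/-- `|wGap| ≤ 1` at `Σ|ζ| ≤ 1`, `θlo ≤ θhi` (def-T FILE 2 `abs_resumWeights_le_one`). [bookkeeping] -/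
theorem abs_wGapAt_le_one (hζ1 : IsZetaAbsLeOne F N ϑ.ν ϑ.τ9.M ϑ.ζ) {θlo θhi : ℝ} (hgap : θlo ≤ θhi) (s' : SeqOfRecord F ϑ.ν ϑ.τ9.M g p.K (k + 1))
    (U : GaugeField (F.P p.K) k (SU N)) (V' : GaugeField (F.P p.K) (k + 1) (SU N)) : |wGapAt F N ϑ θlo θhi p g k s' U V'| ≤ 1 := by
  rw [wGapAt_apply]
  exact abs_resumWeights_le_one _ _ (fun s U V' => sum_abs_ωGapAt_le_one F N ϑ p g k hζ1 hgap _ s U V') s' U V'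

/-- the gapped (3.2) weight is measurable in `V′` ((H-U) is K0c's absolute `localBgMeasurable`). [bookkeeping] -/
theorem measurable_aGapAt (θlo θhi : ℝ) (s : SeqOfRecord F ϑ.ν ϑ.τ9.M g p.K k) (Pl : Finset (Iχ F ϑ.ν p g k)) :
    Measurable (aGapAt F N ϑ.ν ϑ.τ9.M p g k θlo θhi s Pl) := by
  have hU : LocalBgMeasurable F N ϑ.ν := localBgMeasurable F N ϑ.ν
  by_cases hP : Pl ⊆ cubes32 F ϑ.ν ϑ.τ9.M p g k s
  · have e : aGapAt F N ϑ.ν ϑ.τ9.M p g k θlo θhi s Pl = fun V' =>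
        (∏ c ∈ cubes32 F ϑ.ν ϑ.τ9.M p g k s \ Pl, chiFactorAt F N ϑ.ν p g k θlo c V') * ∏ c ∈ Pl, (1 - chiFactorAt F N ϑ.ν p g k θhi c V') :=
      funext fun V' => aGapAt_of_subset F N ϑ.ν ϑ.τ9.M p g k θlo θhi s hP V'
    rw [e]
    exact (Finset.measurable_prod _ fun c _ => measurable_chiFactorAt_of_localBg hU p g k θlo c).mul
      (Finset.measurable_prod _ fun c _ => measurable_const.sub (measurable_chiFactorAt_of_localBg hU p g k θhi c))
  · have e : aGapAt F N ϑ.ν ϑ.τ9.M p g k θlo θhi s Pl = fun _ => 0 := funext fun V' => aGapAt_of_not_subset F N ϑ.ν ϑ.τ9.M p g k θlo θhi s hP V'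
    rw [e]
    exact measurable_const

/-- the gapped label weights are jointly measurable under (H-ζ). [bookkeeping] -/
theorem measurable_ωGapAt (hζm : ZetaMeasurable F N ϑ.ζ) (θlo θhi δ' : ℝ) (s : SeqOfRecord F ϑ.ν ϑ.τ9.M g p.K k) (t : LbOfRecord F ϑ.ν p g k) :
    Measurable (fun z : GaugeField (F.P p.K) (k + 1) (SU N) × GaugeField (F.P p.K) k (SU N) =>
      ωGapAt F N ϑ.ν ϑ.τ9.M p g k θlo θhi δ' ϑ.ζ s t z.2 z.1) := by
  unfold ωGapAt
  exact (((measurable_aGapAt F N ϑ p g k θlo θhi s t.1).comp measurable_fst).mul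
    (measurable_bWeightAt_of_localBg (localBgMeasurable F N ϑ.ν) ϑ.τ9.M p g k δ' s t.1 t.2.1)).mul (hζm p g k s t.1 t.2.1 t.2.2)

/-- the gapped step weights are jointly measurable under (H-ζ) (def-T FILE 2 `measurable_resumWeights`). [bookkeeping] -/
theorem measurable_wGapAt (hζm : ZetaMeasurable F N ϑ.ζ) (θlo θhi : ℝ) (s' : SeqOfRecord F ϑ.ν ϑ.τ9.M g p.K (k + 1)) :
    Measurable (fun z : GaugeField (F.P p.K) (k + 1) (SU N) × GaugeField (F.P p.K) k (SU N) => wGapAt F N ϑ θlo θhi p g k s' z.2 z.1) := by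
  rw [wGapAt_apply]
  exact measurable_resumWeights _ _ (fun s t => measurable_ωGapAt F N ϑ p g k hζm θlo θhi _ s t) s'

end StepWeights

/-! ## §28 The gapped top slot, the gapped core, the two-sided collar shell, the collar count functional -/

section GapTop

variable (F : T4Family) (N : ℕ) [NeZero N] (ϑ : Stage9Params F N) (D : FiniteEpsData F (SU N)) (g₀ : ℕ → ℝ) (os : List (ULoop F))
  (p : B12.RunParams) (g : ℕ → ℝ) (k : ℕ)

/-- ★ **THE GAPPED TOP SLOT** of a level-`(k+1)` history `s′` at source `t`: the 𝐓-step of the run's dressed level-`k` slots OF RECORD with the GAPPED step weights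
(old front factor at `topLetter ν θlo`, i.e. print's `ε_k` below the top). [bookkeeping] -/
def topGapSlotAt (θlo θhi t : ℝ) (s' : SeqOfRecord F ϑ.ν ϑ.τ9.M g p.K (k + 1)) : GaugeField (F.P p.K) (k + 1) (SU N) → ℝ :=
  tstepOfRecordAt F N ϑ.ν ϑ.τ9.M (topLetter ϑ.ν θlo) (wGapAt F N ϑ θlo θhi) p g k (dressedSlotsOfDatum₉ F N ϑ D g₀ os t p g k) s'

/-- **THE GAPPED CORE** of `s′`: `∫ χ_{k+1}^{θlo}(Ω_{k+1}(s′))·topGapSlot^{θlo,θhi}(s′) dV` — the part of the term with every inside cube passing at `θlo` and every new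
large-field cube failing at `θhi`: NO top cube statistic in the open collar `(θlo, θhi)`. [bookkeeping] -/
def topGapCoreAt (θlo θhi t : ℝ) (s' : SeqOfRecord F ϑ.ν ϑ.τ9.M g p.K (k + 1)) : ℝ :=
  ∫ V, chiSeqOfRecordAt F N ϑ.ν ϑ.τ9.M g p.K (k + 1) θlo s' V * topGapSlotAt F N ϑ D g₀ os p g k θlo θhi t s' V ∂fieldMeasure (F.P p.K) (k + 1) (SU N)

/-- ★ **THE TWO-SIDED COLLAR SHELL** of the top-lettered term at `θ` with collar `(θlo, θhi)`: `topClassWeight^{θ}(s′) − topGapCore^{θlo,θhi}(s′)` — for `θlo ≤ θ ≤ θhi` the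
part of the term on which SOME top cube statistic lies in the collar (companion: `0 ≤ shell ≤ term`, cover, pigeonhole). [bookkeeping] -/
def topGapShellAt (θlo θ θhi t : ℝ) (s' : SeqOfRecord F ϑ.ν ϑ.τ9.M g p.K (k + 1)) : ℝ :=
  topClassWeightAt F N ϑ D g₀ os p g k θ t s' - topGapCoreAt F N ϑ D g₀ os p g k θlo θhi t s'

/-- Unfolding of the gapped top slot through def-T's `tstepOfRecordAt_apply`. [bookkeeping] -/
theorem topGapSlotAt_apply (θlo θhi t : ℝ) (s' : SeqOfRecord F ϑ.ν ϑ.τ9.M g p.K (k + 1)) (V : GaugeField (F.P p.K) (k + 1) (SU N)) :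
    topGapSlotAt F N ϑ D g₀ os p g k θlo θhi t s' V =
      transportOfRecord F N p.K k (fun U => wGapAt F N ϑ θlo θhi p g k s' U V *
        (chiSeqOfRecordAt F N ϑ.ν ϑ.τ9.M g p.K k (topLetter ϑ.ν θlo p g k) s'.init U * dressedSlotsOfDatum₉ F N ϑ D g₀ os t p g k s'.init U)) V :=
  tstepOfRecordAt_apply F N ϑ.ν ϑ.τ9.M (topLetter ϑ.ν θlo) (wGapAt F N ϑ θlo θhi) p g k _ s' V

/-- Face: the shell plus the gapped core is the term (definitional bookkeeping). [bookkeeping] -/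
theorem topGapShellAt_add_topGapCoreAt (θlo θ θhi t : ℝ) (s' : SeqOfRecord F ϑ.ν ϑ.τ9.M g p.K (k + 1)) :
    topGapShellAt F N ϑ D g₀ os p g k θlo θ θhi t s' + topGapCoreAt F N ϑ D g₀ os p g k θlo θhi t s' = topClassWeightAt F N ϑ D g₀ os p g k θ t s' := by
  unfold topGapShellAt
  ring

/-- `0 ≤` the gapped top slot (`wGap ≥ 0`, `χ_k ≥ 0`, `slot_k ≥ 0`; def-T `transportOfRecord_nonneg`). [bookkeeping] -/
theorem topGapSlotAt_nonneg (hζ0 : ∀ p g k s Pl Ql RS U V', 0 ≤ ϑ.ζ p g k s Pl Ql RS U V') (θlo θhi t : ℝ) (s' : SeqOfRecord F ϑ.ν ϑ.τ9.M g p.K (k + 1))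
    (V : GaugeField (F.P p.K) (k + 1) (SU N)) : 0 ≤ topGapSlotAt F N ϑ D g₀ os p g k θlo θhi t s' V := by
  rw [topGapSlotAt_apply]
  exact transportOfRecord_nonneg F N p.K k _ (fun U => mul_nonneg (wGapAt_nonneg F N ϑ p g k hζ0 θlo θhi s' U V)
    (mul_nonneg (chiSeqOfRecordAt_nonneg F N ϑ.ν ϑ.τ9.M g p.K k _ _ U)
      (dressedSlotsOfDatum₉_nonneg F N ϑ D g₀ os p g (wOfRecord₉_nonneg ϑ hζ0 p g) t k _ U))) V

/-- (R) `0 ≤` the gapped core. [bookkeeping] -/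
theorem topGapCoreAt_nonneg (hζ0 : ∀ p g k s Pl Ql RS U V', 0 ≤ ϑ.ζ p g k s Pl Ql RS U V') (θlo θhi t : ℝ) (s' : SeqOfRecord F ϑ.ν ϑ.τ9.M g p.K (k + 1)) :
    0 ≤ topGapCoreAt F N ϑ D g₀ os p g k θlo θhi t s' :=
  integral_nonneg fun V => mul_nonneg (chiSeqOfRecordAt_nonneg F N ϑ.ν ϑ.τ9.M g p.K (k + 1) θlo s' V)
    (topGapSlotAt_nonneg F N ϑ D g₀ os p g k hζ0 θlo θhi t s' V)

/-- (R) the shell never exceeds the term (the gapped core is `≥ 0`). [bookkeeping] -/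
theorem topGapShellAt_le_topClassWeightAt (hζ0 : ∀ p g k s Pl Ql RS U V', 0 ≤ ϑ.ζ p g k s Pl Ql RS U V') (θlo θ θhi t : ℝ)
    (s' : SeqOfRecord F ϑ.ν ϑ.τ9.M g p.K (k + 1)) :
    topGapShellAt F N ϑ D g₀ os p g k θlo θ θhi t s' ≤ topClassWeightAt F N ϑ D g₀ os p g k θ t s' :=
  sub_le_self _ (topGapCoreAt_nonneg F N ϑ D g₀ os p g k hζ0 θlo θhi t s')

end GapTop

section Collar

variable (F : T4Family) (N : ℕ) [NeZero N] (ν : Stage7Numerics) (p : B12.RunParams) (g : ℕ → ℝ) (k : ℕ)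

/-- **THE COLLAR COUNT FUNCTIONAL** of the collar `[θlo, θhi)`: `Σ_{c : Iχ} (χf^{θhi}_c(V′) − χf^{θlo}_c(V′))` over ALL χ_{k+1}-cubes — for `θlo ≤ θhi` the number of cubes
whose (2.17) statistic passes at `θhi` and fails at `θlo`. [bookkeeping] -/
def collarAt (θlo θhi : ℝ) (V' : GaugeField (F.P p.K) (k + 1) (SU N)) : ℝ :=
  ∑ c : Iχ F ν p g k, (chiFactorAt F N ν p g k θhi c V' - chiFactorAt F N ν p g k θlo c V')

/-- `0 ≤` the collar count for `θlo ≤ θhi`. [bookkeeping] -/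
theorem collarAt_nonneg {θlo θhi : ℝ} (h : θlo ≤ θhi) (V' : GaugeField (F.P p.K) (k + 1) (SU N)) : 0 ≤ collarAt F N ν p g k θlo θhi V' :=
  Finset.sum_nonneg fun c _ => sub_nonneg.2 (chiFactorAt_mono F N ν p g k h c V')

/-- the collar count is at most the number of χ_{k+1}-cubes. [bookkeeping] -/
theorem collarAt_le_card (θlo θhi : ℝ) (V' : GaugeField (F.P p.K) (k + 1) (SU N)) :
    collarAt F N ν p g k θlo θhi V' ≤ Fintype.card (Iχ F ν p g k) := by
  unfold collarAt
  calc ∑ c : Iχ F ν p g k, (chiFactorAt F N ν p g k θhi c V' - chiFactorAt F N ν p g k θlo c V') ≤ ∑ _c : Iχ F ν p g k, (1 : ℝ) :=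
        Finset.sum_le_sum fun c _ => by
          have h1 := chiFactorAt_le_one F N ν p g k θhi c V'
          have h0 := chiFactorAt_nonneg F N ν p g k θlo c V'
          linarith
    _ = Fintype.card (Iχ F ν p g k) := by rw [Finset.sum_const, nsmul_eq_mul, mul_one, Finset.card_univ]

/-- `|collar| ≤ #cubes` (each summand lies in `[−1, 1]`). [bookkeeping] -/
theorem abs_collarAt_le_card (θlo θhi : ℝ) (V' : GaugeField (F.P p.K) (k + 1) (SU N)) :
    |collarAt F N ν p g k θlo θhi V'| ≤ Fintype.card (Iχ F ν p g k) := by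
  unfold collarAt
  refine (Finset.abs_sum_le_sum_abs _ _).trans ?_
  calc ∑ c : Iχ F ν p g k, |chiFactorAt F N ν p g k θhi c V' - chiFactorAt F N ν p g k θlo c V'| ≤ ∑ _c : Iχ F ν p g k, (1 : ℝ) :=
        Finset.sum_le_sum fun c _ => by
          have h1 := chiFactorAt_le_one F N ν p g k θhi c V'
          have h0 := chiFactorAt_nonneg F N ν p g k θhi c V'
          have h1' := chiFactorAt_le_one F N ν p g k θlo c V'
          have h0' := chiFactorAt_nonneg F N ν p g k θlo c V'
          rw [abs_le]; constructor <;> linarith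
    _ = Fintype.card (Iχ F ν p g k) := by rw [Finset.sum_const, nsmul_eq_mul, mul_one, Finset.card_univ]

/-- the collar count is measurable ((H-U) absolute). [bookkeeping] -/
theorem measurable_collarAt (θlo θhi : ℝ) : Measurable (collarAt F N ν p g k θlo θhi) := by
  have hU : LocalBgMeasurable F N ν := localBgMeasurable F N ν
  unfold collarAt
  exact Finset.measurable_sum _ fun c _ => (measurable_chiFactorAt_of_localBg hU p g k θhi c).sub (measurable_chiFactorAt_of_localBg hU p g k θlo c)

/-- **THE COUNT**: at the top (`k + 1 = p.K`) the χ_{k+1}-cube family has at most `(2L^m)⁴` members (g9 `card_cubeIndices_top_le`). [bookkeeping] -/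
theorem card_Iχ_top_le (hk : k + 1 = p.K) : (Fintype.card (Iχ F ν p g k) : ℝ) ≤ (2 * (F.L : ℝ) ^ F.m) ^ 4 := by
  rw [Fintype.card_coe]
  unfold sideχ
  rw [hk]
  exact card_cubeIndices_top_le F p.K _ _

end Collar

end Summit.QuantumFields.YangMills.Theorems.N21ShellSplitOfRecord13CoPH

end
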